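import Summits.CriticalPhenomena.PercolationContinuityZ3.Theorems.PercNearOneGluingNoHeavyLowerTailUniformLevelDP
import Summits.CriticalPhenomena.PercolationContinuityZ3.Theorems.PercNearOneGluingNoHeavyLowerTailUniformCertLeSix
import Summits.CriticalPhenomena.PercolationContinuityZ3.Theorems.AdditiveGluing.Negative.CertIsoSeven

/-!
# `NoHeavyLowerTail` (crux stmt-CriticalPhenomena-4575 ≡ KN Conjecture 3), certificate programme:
# additive gluing at EVERY uniform density on all simple graphs with at most SEVEN vertices
# (block-pruned search, level-polynomial partition DP; computational, `native_decide`)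

The all-density counterpart of the tree's frontier `additiveGluing_half_le_seven` (`CertIsoSeven.lean`,
density `1/2`).  The search is the block-pruned search `goB` of `CertIsoSeven.lean` verbatim — vertex
pairs in decreasing order of code bit (`pairsDesc`), pruning at the last pair of each row by the
recodings `blkL` of the permutations fixing the lower vertices (`CertBlockPrune`: a code-minimal graph
survives every such test), one surviving leaf per isomorphism class (`1044` on `Fin 7`) — but the
integer-count programme `stepH` and the density-`1/2` leaf `checkDH` are replaced by the LEVEL-POLYNOMIAL
programme `stepHP` and the graded leaf check `checkLP` of `…UniformLevelDP.lean`, whose guarantee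
(`checkLP_spec`: `∃ a ∈ A, ∀ k, #_k{o ↮ b} ≤ #_k{o ↮ b, o ↮ A} + #_k{a ↮ b}`) is, by the bridge
`…UniformLevelCounting.lean`, additive gluing at every `p ∈ [0, 1]` at once:

* `goBP`, `agIsoBP n` — the search; `goBP_imp`, `exists_checkLP_of_agIsoBP` — every graph has a
  relabelling (the code-minimal one) whose leaf passed `checkLP` (proofs of `goB_imp` /
  `exists_checkDH_of_agIsoB`, with the new step and leaf);
* `real_compl_le_of_checkLP` — the relay at the measure level for EVERY `p`:
  `P_p(o ↮ b) ≤ P_p(o ↮ b, o ↮ A) + P_p(a ↮ b)` (`lvCnt_eq_card`, `avoid_iff_not_mem_openConn`,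
  `avoid_or_iff`, `uniformOn_real_le_add_of_levelCount_le`); `additiveGluing_uniform_of_checkLP`;
  `additiveGluing_uniform_of_agIsoBP` (transport back from `G.map σ` by `real_*_map_perm`);
* THE CERTIFICATE `agIsoBP_seven : agIsoBP 7 = true` (`native_decide`, ≈ 155 s: `67 s` of
  isomorphism pruning as in `agIsoB_seven`, the rest the programme and `1044` leaf checks over `22`
  levels) and the registered stubs `additiveGluing_uniform_le_seven` (with `additiveGluing_uniform_le_six`
  below seven) and `additiveGluing_uniform_completeSeven`: for every `n ≤ 7`, every
  `G : SimpleGraph (Fin n)`, EVERY `p ∈ [0, 1]` and all `A o b`, `P_p(o ↔ A) − t ≤ P_p(o ↔ b)` whenever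
  `t ≥ 0` and `P_p(a ↔ b) ≥ 1 − t` on `A`.

Sorry-free with the standard axioms plus `Lean.ofReduceBool` confined to `agIsoBP_seven` (and the
`agIsoL_*` evaluations behind `additiveGluing_uniform_le_six`).  Nothing here asserts or refutes the
crux (these are its finitely-checkable linear proxy on a window); no proposition is defined.
-/

namespace Summit.CriticalPhenomena.PercolationContinuityZ3.Theorems

open MeasureTheory
open Literature.Probability.LatticeModels Literature.Probability.Percolation
open Summit.CriticalPhenomena.PercolationContinuityZ3.Theorems.AdditiveGluing.Negative.Cert

/-! ## Part 1. The block-pruned search with the level-polynomial programme (computable) -/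

section Checker

/-- The block-pruned search of `CertIsoSeven.goB` with the level-polynomial programme `stepHP` and
the leaf `checkLP`: along the pairs (in decreasing order of code bit), at the last pair `(r, r+1)`
of a row prune if some recoding in `blk r` lowers the code; at a leaf, run the level check. -/
def goBP (n : ℕ) (blk : ℕ → List (List (ℕ × ℕ))) :
    List (Fin n × Fin n) → List (List ℕ × List ℕ) → ℕ → Bool
  | [], d, _ => checkLP n d
  | p :: ps, d, c =>
    ((decide (p.2.val = p.1.val + 1) && lowersL (blk p.1.val) c) || goBP n blk ps d c) &&
    ((decide (p.2.val = p.1.val + 1) && lowersL (blk p.1.val) (c ||| 2 ^ slot n p.1 p.2)) ||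
      goBP n blk ps (stepHP d p.1 p.2) (c ||| 2 ^ slot n p.1 p.2))

/-- THE BLOCK-PRUNED LEVEL CHECK: the graded additive-gluing test `checkLP` on every simple graph on
`Fin n` up to isomorphism (from the initial state `[(range n, [1])]`, code `0`). -/
def agIsoBP (n : ℕ) : Bool :=
  let bl := blkL n
  goBP n (fun r => bl.getD r []) (pairsDesc n) [(List.range n, [1])] 0

end Checker

/-! ## Part 2. Soundness of the search -/

/-- **What the search guarantees.** Along a strictly decreasing list of pairs, from a code with no
bit at or below the remaining pairs: every sub-list is either pruned at some block boundary
`(r, r+1)` — with argument the high part of its final code — or its states (processed from `d`)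
pass `checkLP` (the proof of `goB_imp`, verbatim). -/
theorem goBP_imp {n : ℕ} (blk : ℕ → List (List (ℕ × ℕ))) : ∀ (ps : List (Fin n × Fin n))
    (d : List (List ℕ × List ℕ)) (c : ℕ), (ps.Pairwise fun p q => slot n q.1 q.2 < slot n p.1 p.2) →
    (∀ k, c.testBit k = true → ∀ q ∈ ps, slot n q.1 q.2 < k) → goBP n blk ps d c = true →
    ∀ es ∈ ps.sublists',
      (∃ p ∈ ps, p.2.val = p.1.val + 1 ∧
        lowersL (blk p.1.val) (hiPart (slot n p.1 p.2) (codeAcc n c es)) = true) ∨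
      checkLP n (es.foldl (fun d q => stepHP d q.1 q.2) d) = true
  | [], d, c, _, _, h, es, hes => by
    rw [List.sublists'_nil, List.mem_singleton] at hes
    subst hes
    exact Or.inr (by simpa [goBP] using h)
  | p :: ps, d, c, hsort, hc, h, es, hes => by
    rw [List.pairwise_cons] at hsort
    rw [goBP, Bool.and_eq_true, Bool.or_eq_true, Bool.or_eq_true, Bool.and_eq_true, Bool.and_eq_true,
      decide_eq_true_eq] at h
    obtain ⟨hA, hB⟩ := h
    have hcp : ∀ k, c.testBit k = true → slot n p.1 p.2 < k := fun k hk => hc k hk p List.mem_cons_self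
    rw [List.sublists'_cons, List.mem_append, List.mem_map] at hes
    rcases hes with hes | ⟨es', hes', rfl⟩
    · have hsub : ∀ q ∈ es, slot n q.1 q.2 < slot n p.1 p.2 := fun q hq =>
        hsort.1 q ((List.mem_sublists'.1 hes).subset hq)
      rcases hA with ⟨hbd, hlow⟩ | hgo
      · refine Or.inl ⟨p, List.mem_cons_self, hbd, ?_⟩
        rwa [hiPart_codeAcc hsub fun k hk => (hcp k hk).le]
      · rcases goBP_imp blk ps d c hsort.2 (fun k hk q hq => hc k hk q (List.mem_cons_of_mem _ hq)) hgo es hes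
          with ⟨p', hp', h'⟩ | h'
        · exact Or.inl ⟨p', List.mem_cons_of_mem _ hp', h'⟩
        · exact Or.inr h'
    · have hsub : ∀ q ∈ es', slot n q.1 q.2 < slot n p.1 p.2 := fun q hq =>
        hsort.1 q ((List.mem_sublists'.1 hes').subset hq)
      have hc1 : ∀ k, (c ||| 2 ^ slot n p.1 p.2).testBit k = true → slot n p.1 p.2 ≤ k := by
        intro k hk
        rw [Nat.testBit_or, Bool.or_eq_true, Nat.testBit_two_pow, decide_eq_true_eq] at hk
        rcases hk with hk | rfl
        · exact (hcp k hk).le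
        · exact le_rfl
      have hacc : codeAcc n c (p :: es') = codeAcc n (c ||| 2 ^ slot n p.1 p.2) es' := rfl
      rcases hB with ⟨hbd, hlow⟩ | hgo
      · refine Or.inl ⟨p, List.mem_cons_self, hbd, ?_⟩
        rwa [hacc, hiPart_codeAcc hsub hc1]
      · rcases goBP_imp blk ps _ _ hsort.2 (fun k hk q hq => lt_of_lt_of_le (hsort.1 q hq) (hc1 k hk)) hgo es' hes'
          with ⟨p', hp', h'⟩ | h'
        · exact Or.inl ⟨p', List.mem_cons_of_mem _ hp', hacc ▸ h'⟩
        · exact Or.inr h'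

/-- The heart of the pruning: for every graph some relabelling of it reached the leaf check, along
its `pairsDesc`-ordered edge list (for `σ*` minimising `codeG (G.map σ)` the leaf is never pruned,
`not_lt_hiPart_of_minimal`; the proof of `exists_checkDH_of_agIsoB`, verbatim). -/
theorem exists_checkLP_of_agIsoBP {n : ℕ} (h : agIsoBP n = true) (G : SimpleGraph (Fin n)) :
    ∃ σ : Equiv.Perm (Fin n), checkLP n ((edgeListDesc (G.map σ)).foldl
      (fun d q => stepHP d q.1 q.2) [(List.range n, [1])]) = true := by
  classical
  obtain ⟨σ, -, hmin⟩ := Finset.exists_min_image Finset.univ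
    (fun σ : Equiv.Perm (Fin n) => codeG (G.map σ)) Finset.univ_nonempty
  refine ⟨σ, ?_⟩
  set G' := G.map σ with hG'
  have hmin' : ∀ σ' : Equiv.Perm (Fin n), codeG G' ≤ codeG (G'.map σ') := fun σ' => by
    rw [hG', codeG_map_map]; exact hmin (σ.trans σ') (Finset.mem_univ _)
  rcases goBP_imp (fun r => (blkL n).getD r []) (pairsDesc n) _ 0 (pairwise_pairsDesc n)
      (fun k hk => by simp at hk) h (edgeListDesc G') (List.mem_sublists'.2 (edgeListDesc_sublist G'))
    with ⟨p, hp, hbd, hlow⟩ | hcheck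
  · exfalso
    have hp1 : p.1.val < n := p.1.2
    rw [blkL, getD_map_range _ _ hp1] at hlow
    obtain ⟨sp, hsp, hlt⟩ := exists_of_lowersL hlow
    obtain ⟨τ, hτmem, rfl⟩ := List.mem_map.1 hsp
    rw [List.mem_filter] at hτmem
    obtain ⟨σ', hσ'⟩ := exists_perm_of_mem_permTabs hτmem.1
    have hfix := fix_of_fixesBelow hτmem.2 hσ'
    rw [recodeL_smPairs, codeAcc_edgeListDesc] at hlt
    have hslot : slot n p.1 p.2 = slot n p.1 (p.1 + 1) := by rw [hbd]
    rw [hslot] at hlt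
    exact not_lt_hiPart_of_minimal G' hmin' σ' hfix τ hσ' hlt
  · exact hcheck

/-! ## Part 3. From a passed leaf to additive gluing at every density -/

/-- `r` misses the bit `y` iff bit `y` of `r` is off. -/
theorem and_two_pow_eq_zero_iff (r y : ℕ) : r &&& 2 ^ y = 0 ↔ r.testBit y = false := by
  rw [← not_iff_not, ← ne_eq, and_ne_zero_iff, Bool.not_eq_false]
  simp only [Nat.testBit_two_pow, decide_eq_true_eq]
  exact ⟨fun ⟨i, hi, hyi⟩ => hyi ▸ hi, fun h => ⟨y, h, rfl⟩⟩

/-- `r` misses `x ||| y` iff it misses both. -/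
theorem and_or_eq_zero_iff (r x y : ℕ) : r &&& (x ||| y) = 0 ↔ r &&& x = 0 ∧ r &&& y = 0 := by
  have key : ∀ m, r &&& m = 0 ↔ ∀ i, r.testBit i = true → m.testBit i = false := fun m => by
    rw [← not_iff_not, ← ne_eq, and_ne_zero_iff]
    simp only [not_forall, Bool.not_eq_false, exists_prop]
  simp only [key, Nat.testBit_or, Bool.or_eq_false_iff]
  exact ⟨fun h => ⟨fun i hi => (h i hi).1, fun i hi => (h i hi).2⟩, fun h i hi => ⟨h.1 i hi, h.2 i hi⟩⟩

/-- Per-configuration agreement: the reach mask of `x` misses `{y}` iff `x ↮ y`. -/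
theorem avoid_iff_not_mem_openConn {n : ℕ} (ω : List (Fin n × Fin n)) (x y : Fin n) :
    ((reachTable n ω).getD x 0 &&& 2 ^ y.val == 0) = true ↔
      (↑(Eset ω) : Set (Sym2 (Fin n))) ∉ openConn x y := by
  rw [beq_iff_eq, and_two_pow_eq_zero_iff, ← testBit_reachTable_iff_mem_openConn, Bool.eq_false_iff]

/-- Per-configuration agreement: the reach mask of `o` misses `{b} ∪ A` iff `o ↮ b` and `o ↮ A`. -/
theorem avoid_or_iff {n : ℕ} (ω : List (Fin n × Fin n)) (o b : Fin n) (A : Finset (Fin n)) :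
    ((reachTable n ω).getD o 0 &&& (2 ^ b.val ||| maskL A.toList) == 0) = true ↔
      (↑(Eset ω) : Set (Sym2 (Fin n))) ∉ openConn o b ∧
        (↑(Eset ω) : Set (Sym2 (Fin n))) ∉ ⋃ a ∈ A, openConn o a := by
  rw [beq_iff_eq, and_or_eq_zero_iff, ← avoid_iff_not_mem_openConn ω o b, beq_iff_eq,
    ← and_maskL_iff_mem_iUnion ω o A, bne_iff_ne, ne_eq, not_not]

open Classical in
/-- **The relay at the level of counts and measures.** If the leaf check passed on the states of
`edgeListDesc G` then for `o ∉ A`, `o ≠ b`, `A ≠ ∅` some `a ∈ A` has, for EVERY `p`,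
`P_p(o ↮ b) ≤ P_p(o ↮ b, o ↮ A) + P_p(a ↮ b)` (level-wise: `checkLP_spec`, `lvCnt_eq_card`, and
`uniformOn_real_le_add_of_levelCount_le`). -/
theorem real_compl_le_of_checkLP {n : ℕ} (G : SimpleGraph (Fin n))
    (hg : checkLP n ((edgeListDesc G).foldl (fun d q => stepHP d q.1 q.2) [(List.range n, [1])]) = true)
    (p : unitInterval) (A : Finset (Fin n)) (o b : Fin n) (hoA : o ∉ A) (hob : o ≠ b) {a₀ : Fin n}
    (ha₀ : a₀ ∈ A) :
    ∃ a ∈ A, (bondPercolation G p).real (openConn o b)ᶜ ≤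
      (bondPercolation G p).real ((openConn o b)ᶜ ∩ (⋃ x ∈ A, openConn o x)ᶜ) +
        (bondPercolation G p).real (openConn a b)ᶜ := by
  set es := edgeListDesc G with hes
  have hnd : (es.map mkE).Nodup := nodup_map_mkE_edgeListDesc G
  obtain ⟨a, hta, hle⟩ := checkLP_spec hg o b hob (maskL_lt A.toList) (maskL_ne_zero ha₀)
    (testBit_maskL_eq_false hoA)
  refine ⟨a, mem_of_testBit_maskL hta, ?_⟩
  rw [bondPercolation_eq_prodBernoulli_uniformOn G p, ← Eset_edgeListDesc G]
  have hQ1 : ∀ (x : Fin n) (ω : List (Fin n × Fin n)),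
      (fun T => T &&& 2 ^ b.val == 0) ((reachTable n ω).getD x 0) = true ↔
        (↑(Eset ω) : Set (Sym2 (Fin n))) ∈ (openConn x b)ᶜ := fun x ω => by
    rw [Set.mem_compl_iff]; exact avoid_iff_not_mem_openConn ω x b
  have hQ2 : ∀ ω : List (Fin n × Fin n),
      (fun T => T &&& (2 ^ b.val ||| maskL A.toList) == 0) ((reachTable n ω).getD o 0) = true ↔
        (↑(Eset ω) : Set (Sym2 (Fin n))) ∈ (openConn o b)ᶜ ∩ (⋃ x ∈ A, openConn o x)ᶜ := fun ω => by
    rw [Set.mem_inter_iff, Set.mem_compl_iff, Set.mem_compl_iff]; exact avoid_or_iff ω o b A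
  refine uniformOn_real_le_add_of_levelCount_le (Eset es) p (openConn o b)ᶜ
    ((openConn o b)ᶜ ∩ (⋃ x ∈ A, openConn o x)ᶜ) (openConn a b)ᶜ fun k => ?_
  have h1 := hle k
  rw [lvCnt_eq_card hnd o _ _ (hQ1 o) k, lvCnt_eq_card hnd o _ _ hQ2 k, lvCnt_eq_card hnd a _ _ (hQ1 a) k] at h1
  exact h1

/-- **Additive gluing at every density from a passed leaf.** If `checkLP` passed on the states of
`edgeListDesc G` then for every `p`, `A`, `o`, `b`, `t ≥ 0` with `P_p(a ↔ b) ≥ 1 − t` on `A`: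
`P_p(o ↔ A) − t ≤ P_p(o ↔ b)` (`1 − P(o ↔ b) ≤ (1 − P(o ↔ A)) + (1 − P(a ↔ b))` from the relay;
the triples skipped by the check — `o ∈ A`, `o = b`, `A = ∅` — hold by `P ≤ 1`, `P(o ↔ o) = 1`,
`P(∅) = 0`). -/
theorem additiveGluing_uniform_of_checkLP {n : ℕ} (G : SimpleGraph (Fin n))
    (hg : checkLP n ((edgeListDesc G).foldl (fun d q => stepHP d q.1 q.2) [(List.range n, [1])]) = true)
    (p : unitInterval) (A : Finset (Fin n)) (o b : Fin n) (t : ℝ) (ht : 0 ≤ t)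
    (hrel : ∀ a ∈ A, 1 - t ≤ (bondPercolation G p).real (openConn a b)) :
    (bondPercolation G p).real (⋃ a ∈ A, openConn o a) - t ≤ (bondPercolation G p).real (openConn o b) := by
  have hPA : (bondPercolation G p).real (⋃ a ∈ A, openConn o a) ≤ 1 := measureReal_le_one
  by_cases hoA : o ∈ A
  · linarith [hrel o hoA]
  by_cases hob : o = b
  · subst hob; rw [real_openConn_self]; linarith
  by_cases hA : A = ∅
  · subst hA
    simp only [Finset.notMem_empty, Set.iUnion_of_empty, Set.iUnion_empty, measureReal_empty]
    linarith [measureReal_nonneg (μ := bondPercolation G p) (s := openConn o b)]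
  obtain ⟨a0, ha0⟩ := Finset.nonempty_iff_ne_empty.2 hA
  obtain ⟨a, haA, hle⟩ := real_compl_le_of_checkLP G hg p A o b hoA hob ha0
  rw [probReal_compl_eq_one_sub (measurableSet_openConn_holds o b),
    probReal_compl_eq_one_sub (measurableSet_openConn_holds a b)] at hle
  have h2 : (bondPercolation G p).real ((openConn o b)ᶜ ∩ (⋃ x ∈ A, openConn o x)ᶜ) ≤
      (bondPercolation G p).real (⋃ x ∈ A, openConn o x)ᶜ := measureReal_mono Set.inter_subset_right
  rw [probReal_compl_eq_one_sub
    (Finset.measurableSet_biUnion A fun a _ => measurableSet_openConn_holds o a)] at h2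
  linarith [hrel a haA]

/-- **Soundness (additive gluing, every density).** If `agIsoBP n = true` then for EVERY simple graph
`G` on `Fin n`, every `p` and all `A o b t`: `t ≥ 0` and `P_p(a ↔ b) ≥ 1 − t` on `A` give
`P_p(o ↔ A) − t ≤ P_p(o ↔ b)` (checked on a code-minimal relabelling `G.map σ`, transported back by
`real_openConn_map_perm` / `real_iUnion_openConn_map_perm`). -/
theorem additiveGluing_uniform_of_agIsoBP {n : ℕ} (h : agIsoBP n = true) (G : SimpleGraph (Fin n))
    (p : unitInterval) (A : Finset (Fin n)) (o b : Fin n) (t : ℝ) (ht : 0 ≤ t)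
    (hrel : ∀ a ∈ A, 1 - t ≤ (bondPercolation G p).real (openConn a b)) :
    (bondPercolation G p).real (⋃ a ∈ A, openConn o a) - t ≤
      (bondPercolation G p).real (openConn o b) := by
  classical
  obtain ⟨σ, hcheck⟩ := exists_checkLP_of_agIsoBP h G
  have hAG := additiveGluing_uniform_of_checkLP (G.map σ) hcheck p (A.image σ) (σ o) (σ b) t ht (by
      intro a' ha'
      obtain ⟨a, ha, rfl⟩ := Finset.mem_image.1 ha'
      rw [real_openConn_map_perm]
      exact hrel a ha)
  rw [Finset.set_biUnion_finset_image, real_iUnion_openConn_map_perm, real_openConn_map_perm] at hAG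
  exact hAG

/-! ## Part 4. The certificate: all simple graphs on at most seven vertices -/

/-- **The certified computation** `agIsoBP 7 = true`: all simple graphs on `Fin 7` by the
block-pruned search (one surviving leaf per isomorphism class, `1044` of them), the level-polynomial
programme along every prefix and the graded additive-gluing test at every leaf, for all `(o, b, A)`
and all `22` levels (`native_decide`, ≈ 155 s; the lead's off-tree enumeration found the same:
`0` failures on `2 762 424` instances). -/
theorem agIsoBP_seven : agIsoBP 7 = true := by native_decide

/-- **Certificate (additive gluing, every density, at most seven vertices).** For every simple graph
`G` on `Fin n`, `n ≤ 7`, Bernoulli bond percolation with ANY parameter `p ∈ [0, 1]`, every relay set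
`A`, vertices `o b` and slack `t ≥ 0` with `P_p(a ↔ b) ≥ 1 − t` for all `a ∈ A`:
`P_p(o ↔ A) − t ≤ P_p(o ↔ b)` (`n ≤ 6`: `additiveGluing_uniform_le_six`; `n = 7`: `agIsoBP_seven`). -/
theorem additiveGluing_uniform_le_seven : ∀ (n : ℕ), n ≤ 7 → ∀ (G : SimpleGraph (Fin n)) (p : unitInterval) (A : Finset (Fin n)) (o b : Fin n) (t : ℝ), 0 ≤ t → (∀ a ∈ A, 1 - t ≤ (Literature.Probability.Percolation.bondPercolation G p).real (Literature.Probability.Percolation.openConn a b)) → (Literature.Probability.Percolation.bondPercolation G p).real (⋃ a ∈ A, Literature.Probability.Percolation.openConn o a) - t ≤ (Literature.Probability.Percolation.bondPercolation G p).real (Literature.Probability.Percolation.openConn o b) := by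
  intro n hn G p A o b t ht hrel
  rcases Nat.lt_or_ge n 7 with h6 | h7
  · exact additiveGluing_uniform_le_six n (by omega) G p A o b t ht hrel
  · have : n = 7 := le_antisymm hn h7
    subst this
    exact additiveGluing_uniform_of_agIsoBP agIsoBP_seven G p A o b t ht hrel

/-- **Certificate (additive gluing, every density, the complete graph `K₇`).** The special case
`G = ⊤` on `Fin 7` of `additiveGluing_uniform_le_seven`. -/
theorem additiveGluing_uniform_completeSeven : ∀ (p : unitInterval) (A : Finset (Fin 7)) (o b : Fin 7) (t : ℝ), 0 ≤ t → (∀ a ∈ A, 1 - t ≤ (Literature.Probability.Percolation.bondPercolation (⊤ : SimpleGraph (Fin 7)) p).real (Literature.Probability.Percolation.openConn a b)) → (Literature.Probability.Percolation.bondPercolation (⊤ : SimpleGraph (Fin 7)) p).real (⋃ a ∈ A, Literature.Probability.Percolation.openConn o a) - t ≤ (Literature.Probability.Percolation.bondPercolation (⊤ : SimpleGraph (Fin 7)) p).real (Literature.Probability.Percolation.openConn o b) := by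
  intro p A o b t ht hrel
  exact additiveGluing_uniform_le_seven 7 le_rfl ⊤ p A o b t ht hrel

end Summit.CriticalPhenomena.PercolationContinuityZ3.Theorems
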